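import Mathlib

/-!
# Scaling and translation covariance of the far (half-line) exterior channel inequality

Analysis/PDE support file (everything proved, no definitions). The one-ended exterior channel
inequality of the 1+1 wave equation `ψ_tt − ψ_xx + V(x)ψ = 0` on a far half-line cone
`{x > x_c + ρ + |t|}` — in the verbatim vocabulary of the Regge–Wheeler channel items of route
PhotonSphereChannels (`FixedModeChannels`, stmt-FinalStateConjecture-10048): energy density
`e = ψ_t² + ψ_x² + Vψ²` written with `deriv`, solutions via `iteratedDeriv 2`, the kernel `P` of
`t`-polynomial `C²` solutions on the cone, exterior energies as `lintegral`s, `liminf` at `±∞`, the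
reduced initial energy as `⨅ p ∈ P` — is covariant under the affine change of variables
`t = ρτ`, `x = x_c + ρy` (`ρ > 0`): if it holds with constant `c` on the UNIT cone `{y > 1 + |τ|}`
for the rescaled potential `V₁(y) = ρ² V(x_c + ρy)` and solution `ψ₁(τ,y) = ψ(ρτ, x_c + ρy)`, then it
holds with the same `c` on the cone of edge `x_c + ρ` for `V, ψ`
(`farChannelInequality_of_unitScale`). Energies scale by `ρ⁻¹`, kernel elements transport
(`p(t,x) = p₁(t/ρ, (x−x_c)/ρ)`), and `liminf` commutes with `t ↦ t/ρ`. No regularity hypotheses are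
needed (Mathlib's `deriv` chain rules for affine reparametrisations are unconditional). This lets the
far-side channel estimate be proved once, at unit scale, for potentials close to `n(n+1)/y²`.
Folklore.
-/

noncomputable section

namespace Literature.Analysis.PDE

open Set Filter MeasureTheory
open scoped _root_.Topology _root_.ENNReal

/-! ### Affine chain rules (unconditional) -/

/-- `d/dx g(a x + b) = a g'(a x + b)`, no differentiability needed. [folklore] -/
theorem deriv_comp_affine (g : ℝ → ℝ) (a b x : ℝ) :
    deriv (fun x => g (a * x + b)) x = a * deriv g (a * x + b) := by
  have h1 : (fun x => g (a * x + b)) = fun x => (fun u => g (u + b)) (a * x) := rfl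
  rw [h1, deriv_comp_mul_left a (fun u => g (u + b)) x, deriv_comp_add_const]
  rfl

/-- `d²/dx² g(a x + b) = a² g''(a x + b)`, no differentiability needed. [folklore] -/
theorem iteratedDeriv_two_comp_affine (g : ℝ → ℝ) (a b x : ℝ) :
    iteratedDeriv 2 (fun x => g (a * x + b)) x = a ^ 2 * iteratedDeriv 2 g (a * x + b) := by
  rw [iteratedDeriv_succ, iteratedDeriv_one, iteratedDeriv_succ, iteratedDeriv_one]
  have h1 : deriv (fun x => g (a * x + b)) = fun x => a * deriv g (a * x + b) :=
    funext fun x => deriv_comp_affine g a b x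
  rw [h1, deriv_const_mul_field, deriv_comp_affine (deriv g) a b x]
  ring

/-! ### The affine change of variables in lower Lebesgue integrals on half-lines -/

/-- `∫⁻_{x > x_c + ρ b} F((x − x_c)/ρ) dx = ρ ∫⁻_{y > b} F(y) dy` for `ρ > 0`. [folklore] -/
theorem lintegral_Ioi_comp_affine (F : ℝ → ℝ≥0∞) {ρ : ℝ} (hρ : 0 < ρ) (xc b : ℝ) :
    ∫⁻ x in Ioi (xc + ρ * b), F (ρ⁻¹ * (x - xc)) = ENNReal.ofReal ρ * ∫⁻ y in Ioi b, F y := by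
  -- the affine measurable equivalence `y ↦ x_c + ρ y`
  set g : ℝ ≃ᵐ ℝ := ((Homeomorph.mulLeft₀ ρ hρ.ne').trans (Homeomorph.addLeft xc)).toMeasurableEquiv
    with hg
  have hgapp : ∀ y, g y = xc + ρ * y := fun y => by
    simp [hg, Homeomorph.toMeasurableEquiv_coe]
  have hmap : Measure.map g volume = ENNReal.ofReal ρ⁻¹ • (volume : Measure ℝ) := by
    have e : (g : ℝ → ℝ) = (fun x => xc + x) ∘ (fun y => ρ * y) := funext fun y => by
      simp [hgapp]
    rw [e, ← Measure.map_map (measurable_const_add xc) (measurable_const_mul ρ),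
      Real.map_volume_mul_left hρ.ne', Measure.map_smul, map_add_left_eq_self,
      abs_of_pos (inv_pos.2 hρ)]
  -- `∫⁻ f(g y) dy = ρ⁻¹ ∫⁻ f`
  have key : ∀ f : ℝ → ℝ≥0∞, ∫⁻ y, f (xc + ρ * y) = ENNReal.ofReal ρ⁻¹ * ∫⁻ x, f x := by
    intro f
    have h := lintegral_map_equiv (μ := volume) f g
    rw [hmap, lintegral_smul_measure] at h
    simp only [hgapp] at h
    rw [← h]; rfl
  -- apply to the indicator of `Ioi (x_c + ρ b)` times `F ∘ (ρ⁻¹(· − x_c))`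
  have hind : ∀ y, (Ioi (xc + ρ * b)).indicator (fun x => F (ρ⁻¹ * (x - xc))) (xc + ρ * y)
      = (Ioi b).indicator F y := by
    intro y
    have hy : ρ⁻¹ * (xc + ρ * y - xc) = y := by rw [add_sub_cancel_left]; field_simp
    by_cases hb : y ∈ Ioi b
    · have : xc + ρ * y ∈ Ioi (xc + ρ * b) := by
        have hb' : b < y := hb
        show xc + ρ * b < xc + ρ * y
        nlinarith
      rw [indicator_of_mem this, indicator_of_mem hb, hy]
    · have : xc + ρ * y ∉ Ioi (xc + ρ * b) := by
        intro h
        have h' : xc + ρ * b < xc + ρ * y := h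
        exact hb (show b < y by nlinarith)
      rw [indicator_of_notMem this, indicator_of_notMem hb]
  have h1 := key ((Ioi (xc + ρ * b)).indicator fun x => F (ρ⁻¹ * (x - xc)))
  simp only [hind] at h1
  rw [lintegral_indicator measurableSet_Ioi, lintegral_indicator measurableSet_Ioi] at h1
  rw [h1, ← mul_assoc, ← ENNReal.ofReal_mul hρ.le, mul_inv_cancel₀ hρ.ne', ENNReal.ofReal_one,
    one_mul]

/-! ### `liminf` under `t ↦ ρ⁻¹ t` and constant multiples -/

/-- `liminf_{t→+∞} u(ρ⁻¹t) = liminf_{+∞} u` and the same at `−∞`, `ρ > 0`. [folklore] -/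
theorem liminf_comp_inv_mul {ρ : ℝ} (hρ : 0 < ρ) (u : ℝ → ℝ≥0∞) :
    liminf (fun t => u (ρ⁻¹ * t)) atTop = liminf u atTop ∧
      liminf (fun t => u (ρ⁻¹ * t)) atBot = liminf u atBot := by
  set eo : ℝ ≃o ℝ := OrderIso.mulLeft₀ ρ⁻¹ (inv_pos.2 hρ) with heo
  have hcoe : (fun t => u (ρ⁻¹ * t)) = u ∘ eo := by
    funext t; rfl
  rw [hcoe, Filter.liminf_comp, Filter.liminf_comp, eo.map_atTop, eo.map_atBot]
  exact ⟨rfl, rfl⟩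

/-- `liminf (a · u) = a · liminf u` in `ℝ≥0∞` for `a ≠ ∞` — this is Mathlib's
`ENNReal.liminf_const_mul_of_ne_top` (`Mathlib/Order/Filter/ENNReal.lean`); kept as a deprecated
alias (librarian dedup-01491). [folklore] -/
@[deprecated ENNReal.liminf_const_mul_of_ne_top (since := "2026-08-16")]
alias liminf_const_mul_ennreal := ENNReal.liminf_const_mul_of_ne_top

/-! ### The covariance statement -/

/-- **Far channel inequality: unit scale ⇒ any edge and scale.** See the module docstring.
[folklore] -/
theorem farChannelInequality_of_unitScale {V : ℝ → ℝ} {ψ : ℝ → ℝ → ℝ} {xc ρ c : ℝ}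
    (hρ : 0 < ρ)
    (hunit :
      let V₁ : ℝ → ℝ := fun y => ρ ^ 2 * V (xc + ρ * y)
      let ψ₁ : ℝ → ℝ → ℝ := fun τ y => ψ (ρ * τ) (xc + ρ * y)
      let e₁ : (ℝ → ℝ → ℝ) → ℝ → ℝ → ℝ := fun φ t x =>
        deriv (fun τ => φ τ x) t ^ 2 + deriv (φ t) x ^ 2 + V₁ x * φ t x ^ 2
      let IsSol₁ : (ℝ → ℝ → ℝ) → ℝ × ℝ → Prop := fun φ z =>
        iteratedDeriv 2 (fun τ => φ τ z.2) z.1 - iteratedDeriv 2 (φ z.1) z.2 + V₁ z.2 * φ z.1 z.2 = 0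
      let Ω₁ : Set (ℝ × ℝ) := {z | 1 + |z.1| < z.2}
      let P₁ : Set (ℝ → ℝ → ℝ) := {p | ContDiffOn ℝ 2 (Function.uncurry p) Ω₁ ∧
        (∀ z ∈ Ω₁, IsSol₁ p z) ∧ ∃ (N : ℕ) (a : ℕ → ℝ → ℝ), ∀ z ∈ Ω₁,
          p z.1 z.2 = ∑ i ∈ Finset.range N, a i z.2 * z.1 ^ i}
      let E₁ : ℝ → ℝ≥0∞ := fun t => ∫⁻ x in Ioi (1 + |t|), ENNReal.ofReal (e₁ ψ₁ t x)
      ENNReal.ofReal c * (⨅ p ∈ P₁, ∫⁻ x in Ioi 1,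
          ENNReal.ofReal (e₁ (fun t y => ψ₁ t y - p t y) 0 x))
        ≤ liminf E₁ atTop + liminf E₁ atBot) :
    let e : (ℝ → ℝ → ℝ) → ℝ → ℝ → ℝ := fun φ t x =>
      deriv (fun τ => φ τ x) t ^ 2 + deriv (φ t) x ^ 2 + V x * φ t x ^ 2
    let IsSol : (ℝ → ℝ → ℝ) → ℝ × ℝ → Prop := fun φ z =>
      iteratedDeriv 2 (fun τ => φ τ z.2) z.1 - iteratedDeriv 2 (φ z.1) z.2 + V z.2 * φ z.1 z.2 = 0
    let Ω : Set (ℝ × ℝ) := {z | xc + ρ + |z.1| < z.2}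
    let P : Set (ℝ → ℝ → ℝ) := {p | ContDiffOn ℝ 2 (Function.uncurry p) Ω ∧
      (∀ z ∈ Ω, IsSol p z) ∧ ∃ (N : ℕ) (a : ℕ → ℝ → ℝ), ∀ z ∈ Ω,
        p z.1 z.2 = ∑ i ∈ Finset.range N, a i z.2 * z.1 ^ i}
    let Eext : ℝ → ℝ≥0∞ := fun t => ∫⁻ x in Ioi (xc + ρ + |t|), ENNReal.ofReal (e ψ t x)
    ENNReal.ofReal c * (⨅ p ∈ P, ∫⁻ x in Ioi (xc + ρ),
        ENNReal.ofReal (e (fun t y => ψ t y - p t y) 0 x))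
      ≤ liminf Eext atTop + liminf Eext atBot := by
  intro e IsSol Ω P Eext
  -- names for the unit-scale objects
  set V₁ : ℝ → ℝ := fun y => ρ ^ 2 * V (xc + ρ * y) with hV₁
  set ψ₁ : ℝ → ℝ → ℝ := fun τ y => ψ (ρ * τ) (xc + ρ * y) with hψ₁
  set e₁ : (ℝ → ℝ → ℝ) → ℝ → ℝ → ℝ := fun φ t x =>
    deriv (fun τ => φ τ x) t ^ 2 + deriv (φ t) x ^ 2 + V₁ x * φ t x ^ 2 with he₁
  set IsSol₁ : (ℝ → ℝ → ℝ) → ℝ × ℝ → Prop := fun φ z =>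
    iteratedDeriv 2 (fun τ => φ τ z.2) z.1 - iteratedDeriv 2 (φ z.1) z.2 + V₁ z.2 * φ z.1 z.2 = 0
    with hIsSol₁
  set Ω₁ : Set (ℝ × ℝ) := {z | 1 + |z.1| < z.2} with hΩ₁
  set P₁ : Set (ℝ → ℝ → ℝ) := {p | ContDiffOn ℝ 2 (Function.uncurry p) Ω₁ ∧
    (∀ z ∈ Ω₁, IsSol₁ p z) ∧ ∃ (N : ℕ) (a : ℕ → ℝ → ℝ), ∀ z ∈ Ω₁,
      p z.1 z.2 = ∑ i ∈ Finset.range N, a i z.2 * z.1 ^ i} with hP₁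
  set E₁ : ℝ → ℝ≥0∞ := fun t => ∫⁻ x in Ioi (1 + |t|), ENNReal.ofReal (e₁ ψ₁ t x) with hE₁
  have key : ENNReal.ofReal c * (⨅ p ∈ P₁, ∫⁻ x in Ioi 1,
      ENNReal.ofReal (e₁ (fun t y => ψ₁ t y - p t y) 0 x)) ≤ liminf E₁ atTop + liminf E₁ atBot :=
    hunit
  have hρ0 : ρ ≠ 0 := hρ.ne'
  have hρi : 0 < ρ⁻¹ := inv_pos.2 hρ
  -- the inverse affine maps
  have hyx : ∀ x, xc + ρ * (ρ⁻¹ * (x - xc)) = x := fun x => by field_simp; ring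
  have htt : ∀ t, ρ * (ρ⁻¹ * t) = t := fun t => by field_simp
  ------------------------------------------------------------------
  -- (1) energy densities transform with the factor `ρ⁻²`
  ------------------------------------------------------------------
  -- for ANY `φ` written as `φ₁` pulled back: `e φ t x = ρ⁻² e₁ φ₁ (ρ⁻¹t) (ρ⁻¹(x−xc))`
  have hdens : ∀ (φ₁ : ℝ → ℝ → ℝ) (t x : ℝ),
      e (fun t x => φ₁ (ρ⁻¹ * t) (ρ⁻¹ * (x - xc))) t x
        = ρ⁻¹ ^ 2 * e₁ φ₁ (ρ⁻¹ * t) (ρ⁻¹ * (x - xc)) := by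
    intro φ₁ t x
    -- time derivative
    have h1 : deriv (fun τ => φ₁ (ρ⁻¹ * τ) (ρ⁻¹ * (x - xc))) t
        = ρ⁻¹ * deriv (fun τ => φ₁ τ (ρ⁻¹ * (x - xc))) (ρ⁻¹ * t) := by
      have := deriv_comp_affine (fun τ => φ₁ τ (ρ⁻¹ * (x - xc))) ρ⁻¹ 0 t
      simp only [add_zero] at this
      exact this
    -- space derivative
    have h2 : deriv (fun y => φ₁ (ρ⁻¹ * t) (ρ⁻¹ * (y - xc))) x
        = ρ⁻¹ * deriv (φ₁ (ρ⁻¹ * t)) (ρ⁻¹ * (x - xc)) := by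
      have e2 : (fun y => φ₁ (ρ⁻¹ * t) (ρ⁻¹ * (y - xc)))
          = fun y => φ₁ (ρ⁻¹ * t) (ρ⁻¹ * y + (-(ρ⁻¹ * xc))) := by
        funext y; congr 1; ring
      rw [e2, deriv_comp_affine (φ₁ (ρ⁻¹ * t)) ρ⁻¹ (-(ρ⁻¹ * xc)) x]
      congr 2; ring
    have hV : V x = ρ⁻¹ ^ 2 * V₁ (ρ⁻¹ * (x - xc)) := by
      simp only [hV₁, hyx x]; field_simp
    show deriv (fun τ => φ₁ (ρ⁻¹ * τ) (ρ⁻¹ * (x - xc))) t ^ 2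
        + deriv (fun y => φ₁ (ρ⁻¹ * t) (ρ⁻¹ * (y - xc))) x ^ 2
        + V x * φ₁ (ρ⁻¹ * t) (ρ⁻¹ * (x - xc)) ^ 2
      = ρ⁻¹ ^ 2 * (deriv (fun τ => φ₁ τ (ρ⁻¹ * (x - xc))) (ρ⁻¹ * t) ^ 2
        + deriv (φ₁ (ρ⁻¹ * t)) (ρ⁻¹ * (x - xc)) ^ 2
        + V₁ (ρ⁻¹ * (x - xc)) * φ₁ (ρ⁻¹ * t) (ρ⁻¹ * (x - xc)) ^ 2)
    rw [h1, h2, hV]; ring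
  -- `ψ` is the pull-back of `ψ₁`
  have hψpull : ψ = fun t x => ψ₁ (ρ⁻¹ * t) (ρ⁻¹ * (x - xc)) := by
    funext t x
    show ψ t x = ψ (ρ * (ρ⁻¹ * t)) (xc + ρ * (ρ⁻¹ * (x - xc)))
    rw [htt, hyx]
  ------------------------------------------------------------------
  -- (2) the exterior energies: `Eext t = ρ⁻¹ E₁ (ρ⁻¹ t)`
  ------------------------------------------------------------------
  have hEext : ∀ t, Eext t = ENNReal.ofReal ρ⁻¹ * E₁ (ρ⁻¹ * t) := by
    intro t
    have hedge : xc + ρ + |t| = xc + ρ * (1 + |ρ⁻¹ * t|) := by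
      rw [abs_mul, abs_of_pos hρi, mul_add, mul_one, ← mul_assoc, mul_inv_cancel₀ hρ0, one_mul,
        add_assoc]
    show (∫⁻ x in Ioi (xc + ρ + |t|), ENNReal.ofReal (e ψ t x))
      = ENNReal.ofReal ρ⁻¹ * ∫⁻ x in Ioi (1 + |ρ⁻¹ * t|), ENNReal.ofReal (e₁ ψ₁ (ρ⁻¹ * t) x)
    have hfun : (fun x => ENNReal.ofReal (e ψ t x))
        = fun x => (fun y => ENNReal.ofReal (ρ⁻¹ ^ 2 * e₁ ψ₁ (ρ⁻¹ * t) y)) (ρ⁻¹ * (x - xc)) := by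
      funext x
      conv_lhs => rw [hψpull]
      rw [hdens ψ₁ t x]
    rw [hedge, hfun, lintegral_Ioi_comp_affine
      (fun y => ENNReal.ofReal (ρ⁻¹ ^ 2 * e₁ ψ₁ (ρ⁻¹ * t) y)) hρ xc (1 + |ρ⁻¹ * t|)]
    have hsplit : ∀ y, ENNReal.ofReal (ρ⁻¹ ^ 2 * e₁ ψ₁ (ρ⁻¹ * t) y)
        = ENNReal.ofReal (ρ⁻¹ ^ 2) * ENNReal.ofReal (e₁ ψ₁ (ρ⁻¹ * t) y) := fun y =>
      ENNReal.ofReal_mul (by positivity)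
    simp only [hsplit]
    rw [lintegral_const_mul' _ _ ENNReal.ofReal_ne_top, ← mul_assoc, ← ENNReal.ofReal_mul hρ.le]
    congr 2
    field_simp
  have hlimTop : liminf Eext atTop = ENNReal.ofReal ρ⁻¹ * liminf E₁ atTop := by
    rw [show Eext = fun t => ENNReal.ofReal ρ⁻¹ * E₁ (ρ⁻¹ * t) from funext hEext,
      ENNReal.liminf_const_mul_of_ne_top ENNReal.ofReal_ne_top, (liminf_comp_inv_mul hρ E₁).1]
  have hlimBot : liminf Eext atBot = ENNReal.ofReal ρ⁻¹ * liminf E₁ atBot := by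
    rw [show Eext = fun t => ENNReal.ofReal ρ⁻¹ * E₁ (ρ⁻¹ * t) from funext hEext,
      ENNReal.liminf_const_mul_of_ne_top ENNReal.ofReal_ne_top, (liminf_comp_inv_mul hρ E₁).2]
  ------------------------------------------------------------------
  -- (3) kernel transport `P₁ → P` and the reduced initial energy
  ------------------------------------------------------------------
  have hinf : (⨅ p ∈ P, ∫⁻ x in Ioi (xc + ρ), ENNReal.ofReal (e (fun t y => ψ t y - p t y) 0 x))
      ≤ ENNReal.ofReal ρ⁻¹ * ⨅ p ∈ P₁, ∫⁻ x in Ioi 1,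
          ENNReal.ofReal (e₁ (fun t y => ψ₁ t y - p t y) 0 x) := by
    rw [ENNReal.mul_iInf_of_ne (by simp [hρ]) ENNReal.ofReal_ne_top]
    refine le_iInf fun p₁ => ?_
    rw [ENNReal.mul_iInf_of_ne (by simp [hρ]) ENNReal.ofReal_ne_top]
    refine le_iInf fun hp₁ => ?_
    obtain ⟨hp₁C, hp₁sol, N, a, hp₁poly⟩ := hp₁
    -- the transported kernel element
    set p : ℝ → ℝ → ℝ := fun t x => p₁ (ρ⁻¹ * t) (ρ⁻¹ * (x - xc)) with hp
    set A : ℝ × ℝ → ℝ × ℝ := fun z => (ρ⁻¹ * z.1, ρ⁻¹ * (z.2 - xc)) with hA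
    have hAC : ContDiff ℝ 2 A := by
      refine ContDiff.prodMk ?_ ?_
      · exact contDiff_const.mul contDiff_fst
      · exact contDiff_const.mul (contDiff_snd.sub contDiff_const)
    have hAmaps : MapsTo A Ω Ω₁ := by
      intro z hz
      have hz' : xc + ρ + |z.1| < z.2 := hz
      show 1 + |ρ⁻¹ * z.1| < ρ⁻¹ * (z.2 - xc)
      rw [abs_mul, abs_of_pos hρi]
      rw [← sub_pos] at hz' ⊢
      have : ρ⁻¹ * (z.2 - xc) - (1 + ρ⁻¹ * |z.1|) = ρ⁻¹ * (z.2 - (xc + ρ + |z.1|)) := by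
        field_simp; ring
      rw [this]
      exact mul_pos hρi hz'
    have hpP : p ∈ P := by
      refine ⟨?_, ?_, ?_⟩
      · -- `C²` on `Ω`
        have : Function.uncurry p = Function.uncurry p₁ ∘ A := by
          funext z; rfl
        rw [this]
        exact hp₁C.comp hAC.contDiffOn hAmaps
      · -- a solution on `Ω`
        intro z hz
        have hsol₁ : iteratedDeriv 2 (fun τ => p₁ τ (A z).2) (A z).1
            - iteratedDeriv 2 (p₁ (A z).1) (A z).2 + V₁ (A z).2 * p₁ (A z).1 (A z).2 = 0 :=
          hp₁sol (A z) (hAmaps hz)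
        show iteratedDeriv 2 (fun τ => p τ z.2) z.1 - iteratedDeriv 2 (p z.1) z.2
            + V z.2 * p z.1 z.2 = 0
        have h1 : iteratedDeriv 2 (fun τ => p τ z.2) z.1
            = ρ⁻¹ ^ 2 * iteratedDeriv 2 (fun τ => p₁ τ (ρ⁻¹ * (z.2 - xc))) (ρ⁻¹ * z.1) := by
          have := iteratedDeriv_two_comp_affine (fun τ => p₁ τ (ρ⁻¹ * (z.2 - xc))) ρ⁻¹ 0 z.1
          simp only [add_zero] at this
          exact this
        have h2 : iteratedDeriv 2 (p z.1) z.2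
            = ρ⁻¹ ^ 2 * iteratedDeriv 2 (p₁ (ρ⁻¹ * z.1)) (ρ⁻¹ * (z.2 - xc)) := by
          have e2 : p z.1 = fun y => p₁ (ρ⁻¹ * z.1) (ρ⁻¹ * y + (-(ρ⁻¹ * xc))) := by
            funext y; simp only [hp]; congr 1; ring
          rw [e2, iteratedDeriv_two_comp_affine (p₁ (ρ⁻¹ * z.1)) ρ⁻¹ (-(ρ⁻¹ * xc)) z.2]
          congr 2; ring
        have hV : V z.2 = ρ⁻¹ ^ 2 * V₁ (ρ⁻¹ * (z.2 - xc)) := by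
          simp only [hV₁, hyx z.2]; field_simp
        have hpz : p z.1 z.2 = p₁ (ρ⁻¹ * z.1) (ρ⁻¹ * (z.2 - xc)) := rfl
        rw [h1, h2, hV, hpz]
        have hsol₁' : iteratedDeriv 2 (fun τ => p₁ τ (ρ⁻¹ * (z.2 - xc))) (ρ⁻¹ * z.1)
            - iteratedDeriv 2 (p₁ (ρ⁻¹ * z.1)) (ρ⁻¹ * (z.2 - xc))
            + V₁ (ρ⁻¹ * (z.2 - xc)) * p₁ (ρ⁻¹ * z.1) (ρ⁻¹ * (z.2 - xc)) = 0 := hsol₁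
        have : ρ⁻¹ ^ 2 * iteratedDeriv 2 (fun τ => p₁ τ (ρ⁻¹ * (z.2 - xc))) (ρ⁻¹ * z.1)
            - ρ⁻¹ ^ 2 * iteratedDeriv 2 (p₁ (ρ⁻¹ * z.1)) (ρ⁻¹ * (z.2 - xc))
            + ρ⁻¹ ^ 2 * V₁ (ρ⁻¹ * (z.2 - xc)) * p₁ (ρ⁻¹ * z.1) (ρ⁻¹ * (z.2 - xc))
            = ρ⁻¹ ^ 2 * (iteratedDeriv 2 (fun τ => p₁ τ (ρ⁻¹ * (z.2 - xc))) (ρ⁻¹ * z.1)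
              - iteratedDeriv 2 (p₁ (ρ⁻¹ * z.1)) (ρ⁻¹ * (z.2 - xc))
              + V₁ (ρ⁻¹ * (z.2 - xc)) * p₁ (ρ⁻¹ * z.1) (ρ⁻¹ * (z.2 - xc))) := by ring
        rw [this, hsol₁', mul_zero]
      · -- polynomial in `t` on `Ω`
        refine ⟨N, fun i x => a i (ρ⁻¹ * (x - xc)) * ρ⁻¹ ^ i, fun z hz => ?_⟩
        have h := hp₁poly (A z) (hAmaps hz)
        show p₁ (ρ⁻¹ * z.1) (ρ⁻¹ * (z.2 - xc))
          = ∑ i ∈ Finset.range N, a i (ρ⁻¹ * (z.2 - xc)) * ρ⁻¹ ^ i * z.1 ^ i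
        have h' : p₁ (ρ⁻¹ * z.1) (ρ⁻¹ * (z.2 - xc))
            = ∑ i ∈ Finset.range N, a i (ρ⁻¹ * (z.2 - xc)) * (ρ⁻¹ * z.1) ^ i := h
        rw [h']
        exact Finset.sum_congr rfl fun i _ => by rw [mul_pow]; ring
    -- the reduced initial energy of `p` is `ρ⁻¹` times that of `p₁`
    have hred : (∫⁻ x in Ioi (xc + ρ), ENNReal.ofReal (e (fun t y => ψ t y - p t y) 0 x))
        = ENNReal.ofReal ρ⁻¹ * ∫⁻ x in Ioi 1,
            ENNReal.ofReal (e₁ (fun t y => ψ₁ t y - p₁ t y) 0 x) := by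
      have hdiff : (fun t y => ψ t y - p t y)
          = fun t x => (fun τ y => ψ₁ τ y - p₁ τ y) (ρ⁻¹ * t) (ρ⁻¹ * (x - xc)) := by
        funext t x
        show ψ t x - p t x = ψ (ρ * (ρ⁻¹ * t)) (xc + ρ * (ρ⁻¹ * (x - xc))) - p t x
        rw [htt, hyx]
      have hfun : (fun x => ENNReal.ofReal (e (fun t y => ψ t y - p t y) 0 x))
          = fun x => (fun y => ENNReal.ofReal (ρ⁻¹ ^ 2
              * e₁ (fun τ y => ψ₁ τ y - p₁ τ y) (ρ⁻¹ * 0) y)) (ρ⁻¹ * (x - xc)) := by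
        funext x
        rw [hdiff, hdens (fun τ y => ψ₁ τ y - p₁ τ y) 0 x]
      have hedge : xc + ρ = xc + ρ * 1 := by ring
      rw [hfun, hedge, lintegral_Ioi_comp_affine (fun y => ENNReal.ofReal (ρ⁻¹ ^ 2
        * e₁ (fun τ y => ψ₁ τ y - p₁ τ y) (ρ⁻¹ * 0) y)) hρ xc 1, mul_zero]
      have hsplit : ∀ y, ENNReal.ofReal (ρ⁻¹ ^ 2 * e₁ (fun τ y => ψ₁ τ y - p₁ τ y) 0 y)
          = ENNReal.ofReal (ρ⁻¹ ^ 2) * ENNReal.ofReal (e₁ (fun τ y => ψ₁ τ y - p₁ τ y) 0 y) :=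
        fun y => ENNReal.ofReal_mul (by positivity)
      simp only [hsplit]
      rw [lintegral_const_mul' _ _ ENNReal.ofReal_ne_top, ← mul_assoc, ← ENNReal.ofReal_mul hρ.le]
      congr 2
      field_simp
    calc (⨅ p ∈ P, ∫⁻ x in Ioi (xc + ρ), ENNReal.ofReal (e (fun t y => ψ t y - p t y) 0 x))
        ≤ ∫⁻ x in Ioi (xc + ρ), ENNReal.ofReal (e (fun t y => ψ t y - p t y) 0 x) :=
          iInf₂_le p hpP
      _ = _ := hred
  ------------------------------------------------------------------
  -- (4) assemble
  ------------------------------------------------------------------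
  calc ENNReal.ofReal c * (⨅ p ∈ P, ∫⁻ x in Ioi (xc + ρ),
          ENNReal.ofReal (e (fun t y => ψ t y - p t y) 0 x))
      ≤ ENNReal.ofReal c * (ENNReal.ofReal ρ⁻¹ * ⨅ p ∈ P₁, ∫⁻ x in Ioi 1,
          ENNReal.ofReal (e₁ (fun t y => ψ₁ t y - p t y) 0 x)) := by gcongr
    _ = ENNReal.ofReal ρ⁻¹ * (ENNReal.ofReal c * ⨅ p ∈ P₁, ∫⁻ x in Ioi 1,
          ENNReal.ofReal (e₁ (fun t y => ψ₁ t y - p t y) 0 x)) := by ring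
    _ ≤ ENNReal.ofReal ρ⁻¹ * (liminf E₁ atTop + liminf E₁ atBot) := by gcongr
    _ = liminf Eext atTop + liminf Eext atBot := by rw [mul_add, hlimTop, hlimBot]

end Literature.Analysis.PDE
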